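import Summits.NavierStokesRegularity.NavierStokesRegularity.Theorems.TypeICertificateLadderTargetRotationDefectWeight
import Literature.Analysis.FluidPDE.PineauVicolWeightBounds
import HarnessLib

/-!
# Crux `Target` (stmt-NavierStokesRegularity-1217), line `killing-twisted-bernoulli-solitons`:
  the rotation-defect bound for one slice of a BREATHER (RDSS profile; tool for reshape (a))

Support file (theorems only, `--supports stmt-NavierStokesRegularity-1217`). Reshape option (a) of
the line's skeleton replaces soliton selection (stub A2') by BREATHER selection (rotated
discretely self-similar profiles, periodic in the self-similar time) plus a shape/time-defect
stub. This file supplies the rotation-defect half of that programme for a single time slice: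
`rotationDefect_norm_gradient_pressure_le_forced` (linear growth of `∇P` for the forced slice
system, extra term `U_s`); `rotationDefect_alpha_mul_integral_errorTerm_le`
(`α ∫ wE ≤ M|α| ∫ ‖U + ½y‖‖RU‖ e^{−|y|²/16}` for `0 ≤ w ≤ M e^{−|y|²/16}`, without the steady
identity); and **the slice bound** `rotationDefect_slice_setIntegral_ball_norm_curl_sq_le`:
`∫_{B_R} |curl U|² ≤ K(C₀, R) · (|α| ∫ ‖U + ½y‖‖RU‖ e^{−|y|²/16} + ∫ ‖U + ½y‖‖U_s‖ e^{−|y|²/16})`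
for smooth divergence-free slices `(U, U_s, P)` of Pineau–Vicol's (1.14a) with
`ΔP = −tr((∇U)²)`, `|U| ≤ C₀/(1+|y|)`, `DU, ΔU, U_s` bounded — the identity (7.9) with `Ū := U`
(tree `PineauVicol2026.integral_weight_mul_norm_curl_sq_slice`) paired with the slice's own
conjugate weight (tree `DriftHyp.exists_weight`). The two defects — rotation `αRU` and time `U_s`
— stay side by side, which is what a breather stratum "almost steady and almost axisymmetric ⇒
trivial" needs. Not here: the RDSS gap lemma / period bookkeeping and the class-level slices.

## References

* B. Pineau, V. Vicol, arXiv:2607.09619 (2026): §1.4 (1.14) p. 7, Lemmas 7.1–7.2 pp. 24–25,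
  §7.3–7.4 (7.7)–(7.10) pp. 25–26, Prop. 5.1 p. 12. [PineauVicol2026]
-/

noncomputable section

namespace Summit.NavierStokesRegularity.NavierStokesRegularity.Theorems

open MeasureTheory Set Function Filter Topology InnerProductSpace Real Metric
open scoped RealInnerProductSpace Laplacian ContDiff BigOperators ENNReal NNReal
open Literature.Analysis.FluidPDE Literature.Analysis.FluidPDE.PineauVicol2026

/-! ### The pressure gradient of the forced slice system -/

/-- **Linear growth of the pressure gradient for the slice system**: if
`U_s + α(JU − DU(Jy)) + ½U + ½DU(y) − ΔU + DU(U) + ∇P = 0` with `|U| ≤ C₀`, `‖DU‖ ≤ C₁`,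
`‖ΔU‖ ≤ C₂`, `‖U_s‖ ≤ C₃`, then
`‖∇P(y)‖ ≤ (C₃ + (|α|(C₀ + C₁) + C₀ + C₁ + C₂ + C₁C₀))(1 + |y|)` (the steady bound applied to the
pressure-like field `∇P + U_s`, plus `‖U_s‖ ≤ C₃`). [cite: PineauVicol2026, (1.14a) (p. 7), Lemma 7.2 (7.3) (p. 25)] -/
theorem rotationDefect_norm_gradient_pressure_le_forced {α C₀ C₁ C₂ C₃ : ℝ}
    {U Us : EuclideanSpace ℝ (Fin 3) → EuclideanSpace ℝ (Fin 3)} {P : EuclideanSpace ℝ (Fin 3) → ℝ}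
    (hC₀ : 0 ≤ C₀) (hUb : ∀ y, ‖U y‖ ≤ C₀) (hC₁ : ∀ y, ‖fderiv ℝ U y‖ ≤ C₁)
    (hC₂ : ∀ y, ‖(Δ U) y‖ ≤ C₂) (hC₃ : ∀ y, ‖Us y‖ ≤ C₃)
    (heq : ∀ y, Us y + α • (rotGen (U y) - fderiv ℝ U y (rotGen y)) + (1 / 2 : ℝ) • U y +
      (1 / 2 : ℝ) • fderiv ℝ U y y - (Δ U) y + fderiv ℝ U y (U y) + gradient P y = 0)
    (y : EuclideanSpace ℝ (Fin 3)) :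
    ‖gradient P y‖ ≤ (C₃ + (|α| * (C₀ + C₁) + C₀ + C₁ + C₂ + C₁ * C₀)) * (1 + ‖y‖) := by
  have hC₁0 : 0 ≤ C₁ := (norm_nonneg _).trans (hC₁ 0)
  have hC₂0 : 0 ≤ C₂ := (norm_nonneg _).trans (hC₂ 0)
  have hC₃0 : 0 ≤ C₃ := (norm_nonneg _).trans (hC₃ 0)
  have hy1 : (1 : ℝ) ≤ 1 + ‖y‖ := by linarith [norm_nonneg y]
  have e := eq_neg_of_add_eq_zero_right (heq y)
  rw [e, norm_neg]
  have e1 : ‖α • (rotGen (U y) - fderiv ℝ U y (rotGen y))‖ ≤ |α| * ((C₀ + C₁) * (1 + ‖y‖)) := by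
    rw [norm_smul, Real.norm_eq_abs]
    exact mul_le_mul_of_nonneg_left (rotationDefect_norm_defect_le hC₀ hUb hC₁ y) (abs_nonneg _)
  have e2 : ‖(1 / 2 : ℝ) • U y‖ ≤ C₀ := by
    rw [norm_smul, Real.norm_of_nonneg (by norm_num)]; nlinarith [hUb y, norm_nonneg (U y)]
  have e3 : ‖(1 / 2 : ℝ) • fderiv ℝ U y y‖ ≤ C₁ * ‖y‖ := by
    rw [norm_smul, Real.norm_of_nonneg (by norm_num)]
    have := (ContinuousLinearMap.le_opNorm (fderiv ℝ U y) y).trans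
      (mul_le_mul_of_nonneg_right (hC₁ y) (norm_nonneg y))
    nlinarith [norm_nonneg (fderiv ℝ U y y), norm_nonneg y]
  have e5 : ‖fderiv ℝ U y (U y)‖ ≤ C₁ * C₀ :=
    (ContinuousLinearMap.le_opNorm _ _).trans (mul_le_mul (hC₁ y) (hUb y) (norm_nonneg _) hC₁0)
  have hsum : ‖Us y + α • (rotGen (U y) - fderiv ℝ U y (rotGen y)) + (1 / 2 : ℝ) • U y +
      (1 / 2 : ℝ) • fderiv ℝ U y y - (Δ U) y + fderiv ℝ U y (U y)‖ ≤
      ‖Us y‖ + ‖α • (rotGen (U y) - fderiv ℝ U y (rotGen y))‖ + ‖(1 / 2 : ℝ) • U y‖ +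
        ‖(1 / 2 : ℝ) • fderiv ℝ U y y‖ + ‖(Δ U) y‖ + ‖fderiv ℝ U y (U y)‖ := by
    refine (norm_add_le _ _).trans (add_le_add ?_ le_rfl)
    refine (norm_sub_le _ _).trans (add_le_add ?_ le_rfl)
    refine (norm_add_le _ _).trans (add_le_add ?_ le_rfl)
    refine (norm_add_le _ _).trans (add_le_add ?_ le_rfl)
    exact norm_add_le _ _
  have k1 : C₀ ≤ C₀ * (1 + ‖y‖) := le_mul_of_one_le_right hC₀ hy1
  have k2 : C₁ * ‖y‖ ≤ C₁ * (1 + ‖y‖) := mul_le_mul_of_nonneg_left (by linarith) hC₁0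
  have k3 : C₂ ≤ C₂ * (1 + ‖y‖) := le_mul_of_one_le_right hC₂0 hy1
  have k4 : C₁ * C₀ ≤ C₁ * C₀ * (1 + ‖y‖) := le_mul_of_one_le_right (mul_nonneg hC₁0 hC₀) hy1
  have k5 : C₃ ≤ C₃ * (1 + ‖y‖) := le_mul_of_one_le_right hC₃0 hy1
  have eCp : (C₃ + (|α| * (C₀ + C₁) + C₀ + C₁ + C₂ + C₁ * C₀)) * (1 + ‖y‖) =
      C₃ * (1 + ‖y‖) + |α| * ((C₀ + C₁) * (1 + ‖y‖)) + C₀ * (1 + ‖y‖) + C₁ * (1 + ‖y‖) +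
        C₂ * (1 + ‖y‖) + C₁ * C₀ * (1 + ‖y‖) := by ring
  linarith [hC₂ y, hC₃ y]

/-! ### The `α`-term of the weighted identity -/

/-- **`α ∫ wE ≤ M|α| ∫ ‖U + ½y‖‖RU‖ e^{−|y|²/16}`** for a weight `0 ≤ w ≤ M e^{−|y|²/16}`
(`|E| ≤ ‖U + ½y‖‖RU‖` pointwise; the estimate inside `rotationDefect_weighted_enstrophy_le`, stated
without the steady identity so that it serves the time-dependent identity (7.9) as well).
[cite: PineauVicol2026, proof of Thm. 1.4 small |α| (p. 13), (7.10) (p. 26)] -/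
theorem rotationDefect_alpha_mul_integral_errorTerm_le
    {U : EuclideanSpace ℝ (Fin 3) → EuclideanSpace ℝ (Fin 3)} {w : EuclideanSpace ℝ (Fin 3) → ℝ}
    {α M : ℝ} (hw0 : ∀ y, 0 ≤ w y) (hwM : ∀ y, w y ≤ M * Real.exp (-(1 / 16 : ℝ) * ‖y‖ ^ 2))
    (iE : Integrable fun y => w y * ((1 / 2 : ℝ) * ⟪rotGen y, U y⟫ +
      ⟪U y + (1 / 2 : ℝ) • y, fderiv ℝ U y (rotGen y)⟫))
    (iF : Integrable fun y => ‖U y + (1 / 2 : ℝ) • y‖ *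
      ‖rotGen (U y) - fderiv ℝ U y (rotGen y)‖ * Real.exp (-‖y‖ ^ 2 / 16)) :
    α * (∫ y, w y * ((1 / 2 : ℝ) * ⟪rotGen y, U y⟫ +
      ⟪U y + (1 / 2 : ℝ) • y, fderiv ℝ U y (rotGen y)⟫)) ≤ M * (|α| * ∫ y, ‖U y + (1 / 2 : ℝ) • y‖ *
      ‖rotGen (U y) - fderiv ℝ U y (rotGen y)‖ * Real.exp (-‖y‖ ^ 2 / 16)) := by
  set Ev : EuclideanSpace ℝ (Fin 3) → ℝ := fun y => (1 / 2 : ℝ) * ⟪rotGen y, U y⟫ +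
      ⟪U y + (1 / 2 : ℝ) • y, fderiv ℝ U y (rotGen y)⟫ with hEv
  set F : EuclideanSpace ℝ (Fin 3) → ℝ := fun y => ‖U y + (1 / 2 : ℝ) • y‖ *
      ‖rotGen (U y) - fderiv ℝ U y (rotGen y)‖ * Real.exp (-‖y‖ ^ 2 / 16) with hF
  have h1 : α * ∫ y, w y * Ev y ≤ |α| * ∫ y, |w y * Ev y| := by
    have := le_abs_self (α * ∫ y, w y * Ev y)
    rw [abs_mul] at this
    refine this.trans (mul_le_mul_of_nonneg_left ?_ (abs_nonneg α))
    have h := norm_integral_le_integral_norm (μ := volume) fun y => w y * Ev y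
    simpa only [Real.norm_eq_abs] using h
  have h2 : ∫ y, |w y * Ev y| ≤ ∫ y, M * F y := by
    refine integral_mono iE.abs (iF.const_mul M) fun y => ?_
    simp only [hEv, hF]
    rw [abs_mul, abs_of_nonneg (hw0 y)]
    have e : Real.exp (-‖y‖ ^ 2 / 16) = Real.exp (-(1 / 16 : ℝ) * ‖y‖ ^ 2) := by congr 1; ring
    rw [e]
    have hE := rotationDefect_abs_errorTerm_le U y
    calc w y * |(1 / 2 : ℝ) * ⟪rotGen y, U y⟫ + ⟪U y + (1 / 2 : ℝ) • y, fderiv ℝ U y (rotGen y)⟫|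
        ≤ M * Real.exp (-(1 / 16 : ℝ) * ‖y‖ ^ 2) *
          (‖U y + (1 / 2 : ℝ) • y‖ * ‖rotGen (U y) - fderiv ℝ U y (rotGen y)‖) :=
          mul_le_mul (hwM y) hE (abs_nonneg _) ((hw0 y).trans (hwM y))
      _ = M * (‖U y + (1 / 2 : ℝ) • y‖ * ‖rotGen (U y) - fderiv ℝ U y (rotGen y)‖ *
          Real.exp (-(1 / 16 : ℝ) * ‖y‖ ^ 2)) := by ring
  rw [integral_const_mul] at h2
  calc α * ∫ y, w y * Ev y ≤ |α| * ∫ y, |w y * Ev y| := h1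
    _ ≤ |α| * (M * ∫ y, F y) := mul_le_mul_of_nonneg_left h2 (abs_nonneg α)
    _ = M * (|α| * ∫ y, F y) := by ring

/-! ### The slice bound -/

/-- **The rotation-defect / time-defect bound for ONE SLICE of a rotated discretely self-similar
profile (profile level).** For every `C₀ > 0` and radius `R` there is `K > 0` (depending on
`C₀`, `R` only) such that: if `U, P` are smooth on `ℝ³`, `∇·U = 0`, `U_s` is continuous, and
`(U, U_s, P)` solve one time slice of Pineau–Vicol's rotated time-dependent profile system
(1.14a), `U_s + α(JU − DU(Jy)) + ½U + ½DU(y) − ΔU + DU(U) + ∇P = 0`, with the pressure Poisson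
equation `ΔP = −tr((∇U)²)` (Lemma 7.1: `P = RᵢRⱼ(UᵢUⱼ)`), the Type-I profile bound
`|U(y)| ≤ C₀/(1+|y|)` and bounded `DU`, `ΔU`, `U_s` (Lemma 7.2), then
`∫_{B_R} |curl U|² ≤ K · (|α| ∫ ‖U + ½y‖ ‖JU − DU(Jy)‖ e^{−|y|²/16} + ∫ ‖U + ½y‖ ‖U_s‖ e^{−|y|²/16})`.
Proof: the pointwise-in-`s` weighted identity (7.9) (tree
`PineauVicol2026.integral_weight_mul_norm_curl_sq_slice`) with `Ū := U` (no fluctuation term),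
`∫ w|Ω|² = α∫ wE − ∫ w⟪U + ½y, U_s⟫`, for the conjugate weight of Prop. 5.1′ of the slice itself;
then the rotation-defect estimate of the steady case plus `|⟪U + ½y, U_s⟫| ≤ ‖U + ½y‖‖U_s‖`.
(Tool for the breather / RDSS version of the line — reshape option (a) of the skeleton; for a
steady profile, `U_s = 0`, it is the steady bound again.)
[cite: PineauVicol2026, §7.3–7.4, (7.7)–(7.9) (pp. 25–26); Prop. 5.1 (p. 12)] -/
theorem rotationDefect_slice_setIntegral_ball_norm_curl_sq_le {C₀ : ℝ} (hC₀ : 0 < C₀) (R : ℝ) :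
    ∃ K : ℝ, 0 < K ∧
    ∀ (α : ℝ) (U Us : EuclideanSpace ℝ (Fin 3) → EuclideanSpace ℝ (Fin 3))
      (P : EuclideanSpace ℝ (Fin 3) → ℝ),
      ContDiff ℝ ∞ U → ContDiff ℝ ∞ P → Continuous Us → VectorCalculus.IsDivFree U →
      (∀ y, Us y + α • (rotGen (U y) - fderiv ℝ U y (rotGen y)) + (1 / 2 : ℝ) • U y +
        (1 / 2 : ℝ) • fderiv ℝ U y y - (Δ U) y + fderiv ℝ U y (U y) + gradient P y = 0) →
      (∀ y, ∑ l, pderiv l (pderiv l P) y =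
        -∑ l, ∑ j, pderiv l (fun z => U z j) y * pderiv j (fun z => U z l) y) →
      (∀ y, ‖U y‖ ≤ C₀ / (1 + ‖y‖)) →
      (∃ C₁ : ℝ, ∀ y, ‖fderiv ℝ U y‖ ≤ C₁) → (∃ C₂ : ℝ, ∀ y, ‖(Δ U) y‖ ≤ C₂) →
      (∃ C₃ : ℝ, ∀ y, ‖Us y‖ ≤ C₃) →
      ∫ y in ball (0 : EuclideanSpace ℝ (Fin 3)) R, ‖curl U y‖ ^ 2 ≤
        K * (|α| * (∫ y, ‖U y + (1 / 2 : ℝ) • y‖ * ‖rotGen (U y) - fderiv ℝ U y (rotGen y)‖ *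
          Real.exp (-‖y‖ ^ 2 / 16)) + ∫ y, ‖U y + (1 / 2 : ℝ) • y‖ * ‖Us y‖ *
          Real.exp (-‖y‖ ^ 2 / 16)) := by
  -- the constants of Prop. 5.1′ at `ε = ¾`
  set M : ℝ := weightUpperConst (EuclideanSpace ℝ (Fin 3)) C₀ (3 / 4) with hM
  set m : ℝ := weightLowerConst (EuclideanSpace ℝ (Fin 3)) C₀ (3 / 4) with hm
  have hMpos : 0 < M := weightUpperConst_pos _ _
  have hmpos : 0 < m := weightLowerConst_pos _ _
  set L : ℝ := m * Real.exp (-(7 / 16 : ℝ) * R ^ 2) with hL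
  have hLpos : 0 < L := mul_pos hmpos (Real.exp_pos _)
  refine ⟨M / L, div_pos hMpos hLpos, ?_⟩
  intro α U Us P hU hP hUsc hdiv heq hΔP hU0 hU1 hU2 hU3
  obtain ⟨C₁, hC₁⟩ := hU1
  obtain ⟨C₂, hC₂⟩ := hU2
  obtain ⟨C₃, hC₃⟩ := hU3
  have hC₃0 : 0 ≤ C₃ := (norm_nonneg _).trans (hC₃ 0)
  have hC₁0 : 0 ≤ C₁ := (norm_nonneg _).trans (hC₁ 0)
  -- the drift hypotheses of Prop. 5.1′ with constant `C₀`
  have hy1 : ∀ y : EuclideanSpace ℝ (Fin 3), (1 : ℝ) ≤ 1 + ‖y‖ := fun y => by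
    linarith [norm_nonneg y]
  have hUb : ∀ y, ‖U y‖ ≤ C₀ := fun y => (hU0 y).trans (div_le_self hC₀.le (hy1 y))
  have hDH : DriftHyp U C₀ :=
    { contDiff := hU
      div_eq_zero := fun y => hdiv y
      norm_le := hUb
      abs_inner_le := fun y => by
        have h1 : |⟪U y, y⟫| ≤ ‖U y‖ * ‖y‖ := abs_real_inner_le_norm _ _
        have h2 : ‖U y‖ * ‖y‖ ≤ C₀ / (1 + ‖y‖) * ‖y‖ :=
          mul_le_mul_of_nonneg_right (hU0 y) (norm_nonneg y)
        have h3 : C₀ / (1 + ‖y‖) * ‖y‖ ≤ C₀ := by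
          rw [div_mul_eq_mul_div, div_le_iff₀ (by linarith [norm_nonneg y])]
          nlinarith [norm_nonneg y]
        linarith }
  -- the weight `w = γ v` of Prop. 5.1′
  obtain ⟨v, hv, hvpos, -, hv2, hG2, hker, hlow, hup⟩ :=
    hDH.exists_weight (ε := 3 / 4) (by norm_num) (by norm_num)
  have hw0 : ∀ y, 0 ≤ gaussWeight y * v y := fun y => (mul_pos (gaussWeight_pos y) (hvpos y)).le
  have hw_smooth : ContDiff ℝ ∞ (fun y => gaussWeight y * v y) := contDiff_gaussWeight.mul hv
  have hw2 : ContDiff ℝ 2 (fun y => gaussWeight y * v y) := hw_smooth.of_le (by norm_cast)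
  have hw_cont : Continuous (fun y => gaussWeight y * v y) := hw_smooth.continuous
  have hw_up : ∀ y, gaussWeight y * v y ≤ M * Real.exp (-(1 / 16 : ℝ) * ‖y‖ ^ 2) := fun y => by
    have h := hup y
    have e : Real.exp (-(1 - 3 / 4 : ℝ) * ‖y‖ ^ 2 / 4) = Real.exp (-(1 / 16 : ℝ) * ‖y‖ ^ 2) := by
      congr 1; ring
    rw [e] at h
    exact h
  have hw_low : ∀ y, m * Real.exp (-(7 / 16 : ℝ) * ‖y‖ ^ 2) ≤ gaussWeight y * v y := fun y => by
    have h := hlow y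
    have e : Real.exp (-(1 + 3 / 4 : ℝ) * ‖y‖ ^ 2 / 4) = Real.exp (-(7 / 16 : ℝ) * ‖y‖ ^ 2) := by
      congr 1; ring
    rw [e] at h
    exact h
  -- continuity of the players
  have hUc : Continuous U := hU.continuous
  have hDUc : Continuous fun y => fderiv ℝ U y := hU.continuous_fderiv (by simp)
  have hUd : Differentiable ℝ U := hU.differentiable (by simp)
  have hPd : Differentiable ℝ P := hP.differentiable (by simp)
  have hJc : Continuous (rotGen : EuclideanSpace ℝ (Fin 3) → EuclideanSpace ℝ (Fin 3)) :=
    rotGenL.continuous.congr fun v => rfl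
  have hRUc : Continuous fun y => rotGen (U y) - fderiv ℝ U y (rotGen y) :=
    (hJc.comp hUc).sub (hDUc.clm_apply hJc)
  have hdriftc : Continuous fun y : EuclideanSpace ℝ (Fin 3) => U y + (1 / 2 : ℝ) • y :=
    hUc.add (continuous_id.const_smul (1 / 2 : ℝ))
  have hHs : ContDiff ℝ ∞ (headPressure (1 / 2) U P) := contDiff_headPressure hU hP _
  have hHc : Continuous (headPressure (1 / 2) U P) := hHs.continuous
  have hsymmc : Continuous fun L : EuclideanSpace ℝ (Fin 3) →L[ℝ] ℝ =>
      (InnerProductSpace.toDual ℝ (EuclideanSpace ℝ (Fin 3))).symm L :=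
    (InnerProductSpace.toDual ℝ (EuclideanSpace ℝ (Fin 3))).symm.continuous
  have hgradHc : Continuous (gradient (headPressure (1 / 2) U P)) :=
    hsymmc.comp (hHs.continuous_fderiv (by simp))
  have hcurlc : Continuous (curl U) := by
    rw [curl_eq_curlCLM_comp]; exact curlCLM.continuous.comp hDUc
  have hEvc : Continuous fun y : EuclideanSpace ℝ (Fin 3) =>
      (1 / 2 : ℝ) * ⟪rotGen y, U y⟫ + ⟪U y + (1 / 2 : ℝ) • y, fderiv ℝ U y (rotGen y)⟫ :=
    (continuous_const.mul (hJc.inner hUc)).add (hdriftc.inner (hDUc.clm_apply hJc))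
  -- pointwise bounds (file `…RotationDefectBounds`)
  set Cp : ℝ := C₃ + (|α| * (C₀ + C₁) + C₀ + C₁ + C₂ + C₁ * C₀) with hCp
  have hCp0 : 0 ≤ Cp := by
    have hC₂0 : 0 ≤ C₂ := (norm_nonneg _).trans (hC₂ 0)
    positivity
  have hB4 : ∀ y, ‖fderiv ℝ P y‖ ≤ Cp * (1 + ‖y‖) := fun y => by
    have h := rotationDefect_norm_gradient_pressure_le_forced hC₀.le hUb hC₁ hC₂ hC₃ heq y
    have e : ‖gradient P y‖ = ‖fderiv ℝ P y‖ := by simp [gradient]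
    rwa [e] at h
  have hB5 : ∀ y, |P y| ≤ (|P 0| + Cp) * (1 + ‖y‖) ^ 2 :=
    rotationDefect_abs_pressure_le hPd hCp0 hB4
  have hB6 : ∀ y, |headPressure (1 / 2) U P y| ≤ (C₀ ^ 2 + (|P 0| + Cp) + C₀) * (1 + ‖y‖) ^ 2 :=
    rotationDefect_abs_head_le hC₀.le hUb hB5
  have hB7 : ∀ y, ‖gradient (headPressure (1 / 2) U P) y‖ ≤ (C₀ * C₁ + Cp + C₀ + C₁) * (1 + ‖y‖) :=
    rotationDefect_norm_gradient_head_le hUd hPd hC₀.le hUb hC₁ hCp0 hB4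
  -- the integrability hypotheses of (5.4)
  have iΩ : Integrable fun y => (gaussWeight y * v y) * ‖curl U y‖ ^ 2 :=
    rotationDefect_integrable_weight_mul (g := fun y => ‖curl U y‖ ^ 2) hw_cont
      ((continuous_norm.comp hcurlc).pow 2) hw0 hw_up
      (C := (‖curlCLM‖ * C₁) ^ 2) (N := 0) fun y => by
        rw [pow_zero, mul_one, abs_of_nonneg (sq_nonneg _)]
        exact rotationDefect_norm_curl_sq_le hC₁ y
  have iE : Integrable fun y => (gaussWeight y * v y) * ((1 / 2 : ℝ) * ⟪rotGen y, U y⟫ +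
      ⟪U y + (1 / 2 : ℝ) • y, fderiv ℝ U y (rotGen y)⟫) :=
    rotationDefect_integrable_weight_mul hw_cont hEvc hw0 hw_up (N := 2)
      (rotationDefect_abs_errorTerm_le_sq hC₀.le hUb hC₁)
  have h₁ : Integrable fun y => |gaussWeight y * v y| * ‖gradient (headPressure (1 / 2) U P) y‖ := by
    have h := rotationDefect_integrable_weight_mul
      (g := fun y => ‖gradient (headPressure (1 / 2) U P) y‖) hw_cont
      (continuous_norm.comp hgradHc) hw0 hw_up
      (N := 1) (C := C₀ * C₁ + Cp + C₀ + C₁) fun y => by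
        rw [abs_of_nonneg (norm_nonneg _), pow_one]; exact hB7 y
    refine h.congr (Eventually.of_forall fun y => ?_)
    simp only [abs_of_nonneg (hw0 y)]
  have h₂ : Integrable fun y => |headPressure (1 / 2) U P y| *
      ‖gradient (fun z => gaussWeight z * v z) y‖ :=
    rotationDefect_integrable_head_mul_gradient_weight hHc hB6 hv hvpos hv2 hG2
  have h₃ : Integrable fun y => |headPressure (1 / 2) U P y| * |gaussWeight y * v y| *
      ‖U y + (1 / 2 : ℝ) • y‖ := by
    have h := rotationDefect_integrable_weight_mul
      (g := fun y => |headPressure (1 / 2) U P y| * ‖U y + (1 / 2 : ℝ) • y‖) hw_cont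
      ((continuous_abs.comp hHc).mul (continuous_norm.comp hdriftc)) hw0 hw_up (N := 3)
      (C := (C₀ ^ 2 + (|P 0| + Cp) + C₀) * (C₀ + 1)) fun y => by
        rw [abs_mul, abs_abs, abs_of_nonneg (norm_nonneg _)]
        calc |headPressure (1 / 2) U P y| * ‖U y + (1 / 2 : ℝ) • y‖
            ≤ (C₀ ^ 2 + (|P 0| + Cp) + C₀) * (1 + ‖y‖) ^ 2 * ((C₀ + 1) * (1 + ‖y‖)) :=
              mul_le_mul (hB6 y) (rotationDefect_norm_drift_le hC₀.le hUb y) (norm_nonneg _)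
                ((abs_nonneg _).trans (hB6 y))
          _ = (C₀ ^ 2 + (|P 0| + Cp) + C₀) * (C₀ + 1) * (1 + ‖y‖) ^ 3 := by ring
    refine h.congr (Eventually.of_forall fun y => ?_)
    simp only [abs_of_nonneg (hw0 y)]; ring
  -- (7.9) with `Ū := U` (no fluctuation term): `∫ w |Ω|² = α ∫ w E − ∫ w ⟪U + ½y, U_s⟫`
  have heq' : ∀ y, Us y + α • (rotGen (U y) - fderiv ℝ U y (rotGen y)) + (1 / 2 : ℝ) • U y +
      (1 / 2 : ℝ) • fderiv ℝ U y y - (Δ U) y + convect U U y + gradient P y = 0 := heq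
  have iT : Integrable fun y => (gaussWeight y * v y) * ⟪U y + (1 / 2 : ℝ) • y, Us y⟫ :=
    rotationDefect_integrable_weight_mul hw_cont (hdriftc.inner hUsc) hw0 hw_up (N := 1)
      (C := (C₀ + 1) * C₃) fun y => by
        calc |⟪U y + (1 / 2 : ℝ) • y, Us y⟫| ≤ ‖U y + (1 / 2 : ℝ) • y‖ * ‖Us y‖ :=
              abs_real_inner_le_norm _ _
          _ ≤ (C₀ + 1) * (1 + ‖y‖) * C₃ :=
              mul_le_mul (rotationDefect_norm_drift_le hC₀.le hUb y) (hC₃ y) (norm_nonneg _)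
                (by nlinarith [hy1 y, hC₀.le])
          _ = (C₀ + 1) * C₃ * (1 + ‖y‖) ^ 1 := by ring
  have iF0 : Integrable fun y => (gaussWeight y * v y) *
      fderiv ℝ (headPressure (1 / 2) U P) y (U y - U y) := by
    have e : (fun y => (gaussWeight y * v y) * fderiv ℝ (headPressure (1 / 2) U P) y (U y - U y)) =
        fun _ => 0 := by funext y; rw [sub_self, map_zero, mul_zero]
    rw [e]; exact integrable_zero _ _ _
  have h79 := integral_weight_mul_norm_curl_sq_slice (Ubar := U) hU hP (hU.of_le (by norm_cast)) hw2
    heq' hdiv hΔP hker iΩ iE iT iF0 h₁ h₂ h₃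
  have hzero : (∫ y, (gaussWeight y * v y) * fderiv ℝ (headPressure (1 / 2) U P) y (U y - U y)) = 0 := by
    have e : (fun y => (gaussWeight y * v y) * fderiv ℝ (headPressure (1 / 2) U P) y (U y - U y)) =
        fun _ => 0 := by funext y; rw [sub_self, map_zero, mul_zero]
    rw [e, integral_zero]
  rw [hzero, neg_zero, zero_add] at h79
  -- right-hand side
  have iF : Integrable fun y => ‖U y + (1 / 2 : ℝ) • y‖ *
      ‖rotGen (U y) - fderiv ℝ U y (rotGen y)‖ * Real.exp (-‖y‖ ^ 2 / 16) := by
    refine rotationDefect_integrable_of_le_poly_gauss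
      (((continuous_norm.comp hdriftc).mul (continuous_norm.comp hRUc)).mul
        (Real.continuous_exp.comp ((continuous_norm.pow 2).neg.div_const _))).aestronglyMeasurable
      (C := (C₀ + 1) * (C₀ + C₁)) (c := 1 / 16) (N := 2) (by norm_num) fun y => ?_
    have e : Real.exp (-‖y‖ ^ 2 / 16) = Real.exp (-(1 / 16 : ℝ) * ‖y‖ ^ 2) := by congr 1; ring
    rw [Real.norm_eq_abs, abs_mul, abs_mul, abs_of_nonneg (norm_nonneg _),
      abs_of_nonneg (norm_nonneg _), abs_of_nonneg (Real.exp_pos _).le, e]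
    have hprod : ‖U y + (1 / 2 : ℝ) • y‖ * ‖rotGen (U y) - fderiv ℝ U y (rotGen y)‖ ≤
        (C₀ + 1) * (C₀ + C₁) * (1 + ‖y‖) ^ 2 := by
      calc ‖U y + (1 / 2 : ℝ) • y‖ * ‖rotGen (U y) - fderiv ℝ U y (rotGen y)‖
          ≤ (C₀ + 1) * (1 + ‖y‖) * ((C₀ + C₁) * (1 + ‖y‖)) :=
            mul_le_mul (rotationDefect_norm_drift_le hC₀.le hUb y)
              (rotationDefect_norm_defect_le hC₀.le hUb hC₁ y) (norm_nonneg _)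
              (by nlinarith [hy1 y, hC₀.le])
        _ = (C₀ + 1) * (C₀ + C₁) * (1 + ‖y‖) ^ 2 := by ring
    calc ‖U y + (1 / 2 : ℝ) • y‖ * ‖rotGen (U y) - fderiv ℝ U y (rotGen y)‖ *
          Real.exp (-(1 / 16 : ℝ) * ‖y‖ ^ 2)
        ≤ (C₀ + 1) * (C₀ + C₁) * (1 + ‖y‖) ^ 2 * Real.exp (-(1 / 16 : ℝ) * ‖y‖ ^ 2) :=
          mul_le_mul_of_nonneg_right hprod (Real.exp_pos _).le
      _ = (C₀ + 1) * (C₀ + C₁) * ((1 + ‖y‖) ^ 2 * Real.exp (-(1 / 16 : ℝ) * ‖y‖ ^ 2)) := by ring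
  have iG : Integrable fun y => ‖U y + (1 / 2 : ℝ) • y‖ * ‖Us y‖ * Real.exp (-‖y‖ ^ 2 / 16) := by
    refine rotationDefect_integrable_of_le_poly_gauss
      (((continuous_norm.comp hdriftc).mul (continuous_norm.comp hUsc)).mul
        (Real.continuous_exp.comp ((continuous_norm.pow 2).neg.div_const _))).aestronglyMeasurable
      (C := (C₀ + 1) * C₃) (c := 1 / 16) (N := 1) (by norm_num) fun y => ?_
    have e : Real.exp (-‖y‖ ^ 2 / 16) = Real.exp (-(1 / 16 : ℝ) * ‖y‖ ^ 2) := by congr 1; ring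
    rw [Real.norm_eq_abs, abs_mul, abs_mul, abs_of_nonneg (norm_nonneg _),
      abs_of_nonneg (norm_nonneg _), abs_of_nonneg (Real.exp_pos _).le, e]
    calc ‖U y + (1 / 2 : ℝ) • y‖ * ‖Us y‖ * Real.exp (-(1 / 16 : ℝ) * ‖y‖ ^ 2)
        ≤ (C₀ + 1) * (1 + ‖y‖) * C₃ * Real.exp (-(1 / 16 : ℝ) * ‖y‖ ^ 2) :=
          mul_le_mul_of_nonneg_right (mul_le_mul (rotationDefect_norm_drift_le hC₀.le hUb y) (hC₃ y)
            (norm_nonneg _) (by nlinarith [hy1 y, hC₀.le])) (Real.exp_pos _).le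
      _ = (C₀ + 1) * C₃ * ((1 + ‖y‖) ^ 1 * Real.exp (-(1 / 16 : ℝ) * ‖y‖ ^ 2)) := by ring
  -- `∫ w|Ω|² ≤ M (|α| ∫F + ∫G)`
  have hrhs : ∫ y, (gaussWeight y * v y) * ‖curl U y‖ ^ 2 ≤
      M * (|α| * (∫ y, ‖U y + (1 / 2 : ℝ) • y‖ * ‖rotGen (U y) - fderiv ℝ U y (rotGen y)‖ *
          Real.exp (-‖y‖ ^ 2 / 16)) + ∫ y, ‖U y + (1 / 2 : ℝ) • y‖ * ‖Us y‖ *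
          Real.exp (-‖y‖ ^ 2 / 16)) := by
    -- the α-term, by the RSS lemma applied to the identity `∫w|Ω|² + ∫wT = α∫wE`
    have hEpart : α * (∫ y, (gaussWeight y * v y) * ((1 / 2 : ℝ) * ⟪rotGen y, U y⟫ +
        ⟪U y + (1 / 2 : ℝ) • y, fderiv ℝ U y (rotGen y)⟫)) ≤
        M * (|α| * ∫ y, ‖U y + (1 / 2 : ℝ) • y‖ * ‖rotGen (U y) - fderiv ℝ U y (rotGen y)‖ *
          Real.exp (-‖y‖ ^ 2 / 16)) := by
      exact rotationDefect_alpha_mul_integral_errorTerm_le hw0 hw_up iE iF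
    -- the time term
    have hTpart : -(∫ y, (gaussWeight y * v y) * ⟪U y + (1 / 2 : ℝ) • y, Us y⟫) ≤
        M * ∫ y, ‖U y + (1 / 2 : ℝ) • y‖ * ‖Us y‖ * Real.exp (-‖y‖ ^ 2 / 16) := by
      rw [← integral_neg, ← integral_const_mul]
      refine integral_mono iT.neg (iG.const_mul M) fun y => ?_
      have e : Real.exp (-‖y‖ ^ 2 / 16) = Real.exp (-(1 / 16 : ℝ) * ‖y‖ ^ 2) := by congr 1; ring
      rw [e]
      have h1 : |(gaussWeight y * v y) * ⟪U y + (1 / 2 : ℝ) • y, Us y⟫| ≤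
          M * Real.exp (-(1 / 16 : ℝ) * ‖y‖ ^ 2) * (‖U y + (1 / 2 : ℝ) • y‖ * ‖Us y‖) := by
        rw [abs_mul, abs_of_nonneg (hw0 y)]
        exact mul_le_mul (hw_up y) (abs_real_inner_le_norm _ _) (abs_nonneg _) ((hw0 y).trans (hw_up y))
      have h2 := neg_abs_le ((gaussWeight y * v y) * ⟪U y + (1 / 2 : ℝ) • y, Us y⟫)
      nlinarith
    linarith
  -- left-hand side
  have hlhs : L * ∫ y in ball (0 : EuclideanSpace ℝ (Fin 3)) R, ‖curl U y‖ ^ 2 ≤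
      ∫ y, (gaussWeight y * v y) * ‖curl U y‖ ^ 2 :=
    rotationDefect_mul_setIntegral_ball_le (R := R) hmpos.le hw_low
      ((continuous_norm.comp hcurlc).pow 2) (fun y => sq_nonneg _) iΩ
  -- assemble
  have key := hlhs.trans hrhs
  rw [div_mul_eq_mul_div, le_div_iff₀ hLpos, mul_comm]
  exact key

/-- **Registered helper stub `rotationDefect_sliceBallEnstrophyBound`** (explicit-binder form of
`rotationDefect_slice_setIntegral_ball_norm_curl_sq_le`). [cite: PineauVicol2026, (7.9) (p. 26), Prop. 5.1 (p. 12)] -/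
theorem rotationDefect_sliceBallEnstrophyBound :
    ∀ (C₀ : ℝ), 0 < C₀ → ∀ (R : ℝ), ∃ K : ℝ, 0 < K ∧ ∀ (α : ℝ) (U Us : EuclideanSpace ℝ (Fin 3) → EuclideanSpace ℝ (Fin 3)) (P : EuclideanSpace ℝ (Fin 3) → ℝ), ContDiff ℝ (⊤ : ℕ∞) U → ContDiff ℝ (⊤ : ℕ∞) P → Continuous Us → Literature.Analysis.FluidPDE.VectorCalculus.IsDivFree U → (∀ y : EuclideanSpace ℝ (Fin 3), Us y + α • (Literature.Analysis.FluidPDE.rotGen (U y) - fderiv ℝ U y (Literature.Analysis.FluidPDE.rotGen y)) + (1 / 2 : ℝ) • U y + (1 / 2 : ℝ) • fderiv ℝ U y y - Laplacian.laplacian U y + fderiv ℝ U y (U y) + gradient P y = 0) → (∀ y : EuclideanSpace ℝ (Fin 3), ∑ l, Literature.Analysis.FluidPDE.pderiv l (Literature.Analysis.FluidPDE.pderiv l P) y = -∑ l, ∑ j, Literature.Analysis.FluidPDE.pderiv l (fun z => U z j) y * Literature.Analysis.FluidPDE.pderiv j (fun z => U z l) y) → (∀ y : EuclideanSpace ℝ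 (Fin 3), ‖U y‖ ≤ C₀ / (1 + ‖y‖)) → (∃ C₁ : ℝ, ∀ y : EuclideanSpace ℝ (Fin 3), ‖fderiv ℝ U y‖ ≤ C₁) → (∃ C₂ : ℝ, ∀ y : EuclideanSpace ℝ (Fin 3), ‖Laplacian.laplacian U y‖ ≤ C₂) → (∃ C₃ : ℝ, ∀ y : EuclideanSpace ℝ (Fin 3), ‖Us y‖ ≤ C₃) → ∫ y in Metric.ball (0 : EuclideanSpace ℝ (Fin 3)) R, ‖Literature.Analysis.FluidPDE.curl U y‖ ^ 2 ≤ K * (|α| * (∫ y : EuclideanSpace ℝ (Fin 3), ‖U y + (1 / 2 : ℝ) • y‖ * ‖Literature.Analysis.FluidPDE.rotGen (U y) - fderiv ℝ U y (Literature.Analysis.FluidPDE.rotGen y)‖ * Real.exp (-‖y‖ ^ 2 / 16)) + ∫ y : EuclideanSpace ℝ (Fin 3), ‖U y + (1 / 2 : ℝ) • y‖ * ‖Us y‖ * Real.exp (-‖y‖ ^ 2 / 16)) :=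
  fun _ hC₀ R => rotationDefect_slice_setIntegral_ball_norm_curl_sq_le hC₀ R

end Summit.NavierStokesRegularity.NavierStokesRegularity.Theorems

end
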